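import Literature.AnabelianGeometry.AbsoluteAnabelian.AbsTopIThm26iiiRankExcessPrep
import Literature.AnabelianGeometry.AbsoluteAnabelian.AbsTopIThm26iiiClauseOneOpen
import HarnessLib

/-!
# [AbsTopI] Thm 2.6 (iii) clause two and Thm 2.6 (v) (`Σ ⊇ Primes`) from the Lemma 2.7 (iii) HOOK

S. Mochizuki, *Topics in Absolute Anabelian Geometry I: Generalities* (2012) [AbsTopI], Thm 2.6
(iii)/(v) p. 22; proof of (iii) clause two p. 23 l. 36–45: "[...] `dim_{ℚ_l}(R_l ⊗ ℚ_l) ≥ 1`.  But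
this implies that for any `l′ ∈ Σ`, we have `dim_{ℚ_{l′}}(R_{l′} ⊗ ℚ_{l′}) ≥ 1`, hence that
`H¹(G, Hom(R_{l′}, ℚ_{l′})) = H¹(G, ℚ_{l′}) ⊗ Hom(R_{l′}, ℚ_{l′}) ≠ 0`.  Thus, by the injections
discussed above [Lemma 2.7 (iii)], we conclude that `ε²_{l′}(Π) ≥ δ²_{l′}(Π) ≥ 1`, so `l′ ∈ θ²(Π)`."

PROOF-ONLY file (no definitions, no named facts) of the abc-iut row «THM26-PRIMES-COROLLARIES» (L4-lead
RULING #8i): the two [AbsTopI] §2 nodes left open by the cell — clause two of Thm 2.6 (iii) and the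
`Σ ⊇ Primes` regime of the general-`Θ` Thm 2.6 (v) — are derived from ONE explicitly bound input, the
"Lemma 2.7 (iii) hook", stated in the tree's `δ`-vocabulary PER OPEN SUBGROUP `J ⊆ Π`:

  (HOOK)  a rank excess at some prime of `Σ` on `J` — `δ¹_{l₀}(G_J) < δ¹_{l₀}(J)`, `l₀ ∈ Σ` —
          forces `{l ∈ Σ | l prime} ⊆ θ²(J)`

(print: excess = `dim(R_{l₀} ⊗ ℚ_{l₀}) ≥ 1` ⇒ `dim(R_{l′} ⊗ ℚ_{l′}) ≥ 1` for all `l′ ∈ Σ` [Lemma 2.7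
(ii)] ⇒ `δ²_{l′}(J) ≥ 1` [Lemma 2.7 (iii)]).  The cell's typing of Lemma 2.7 (rows «LEM27iii-TYPE»,
`Thm26iii′` with its G-module datum (M)) is to PRODUCE the hook; here everything downstream of it is
kernel-checked for every extension with MLF base data:

* `MLFBase.subset_thetaSet_two_of_hook` — clause two at every open `H`: `|θ¹(H)| ≥ 2 ⇒ Σ ⊆ θ²(H)`
  (this seat's `exists_open_rankExcess_of_two_le_encard` + HOOK + `thetaSet_mono_of_isOpen`);
* `MLFBase.thm26iii_of_hook` — the typed `E.Thm26iii S` (clause one = abc-iut-w6-d073's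
  `thetaSet_two_subset_of_isProSet`, via `thm26iii_iff_of_isProSet`);
* `MLFBase.thm26vFull_of_hook` — the typed general-`Θ` `E.Thm26vFull B` for every `Σ ⊆ Primes`
  (via this seat's `thm26vFull_of_isProSet_of_subset`), the rank identity of (ii) per open `Π′` being
  needed only when `Σ ⊇ Primes`; and `MLFBase.thm26vFull_of_starCondition_of_hook` (splitting + (∗)).

HONEST FRAMING: PROVED MODULO exactly the hook (= Lemma 2.7 (ii)+(iii) at geometric data; NOT a
theorem of the abstract hypotheses — abc-iut finding F-w6d073-1); refereed, undisputed paper; seat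
abc-iut-w6-d034; nothing here bears on [IUTchIII] Cor. 3.12.
-/

noncomputable section

namespace Literature.AnabelianGeometry.AbsoluteAnabelian

namespace FundamentalExtension

variable {E : FundamentalExtension.{0}}

/-- **Clause two of [AbsTopI] Thm 2.6 (iii) at every open `H ⊆ Π`, from the Lemma 2.7 (iii) hook**:
for an extension with MLF base data and `Δ` pro-`Σ`, if every open `J ⊆ Π` carrying a rank excess
`δ¹_{l₀}(G_J) < δ¹_{l₀}(J)` at some `l₀ ∈ Σ` satisfies `{l ∈ Σ | l prime} ⊆ θ²(J)`, then
`|θ¹(H)| ≥ 2 ⇒ {l ∈ Σ | l prime} ⊆ θ²(H)` for every open `H`.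
[cite: MochizukiAbsTopI2012, Thm 2.6 (iii) proof p.23] -/
theorem MLFBase.subset_thetaSet_two_of_hook (B : E.MLFBase) {S : Set ℕ} (hΔS : IsProSet E.geom S)
    (hook : ∀ (J : Subgroup E.arith), IsOpen (J : Set E.arith) →
      (∃ (l₀ : ℕ) (_ : Fact l₀.Prime), l₀ ∈ S ∧
        freeProlRank (J.map E.aug.toMonoidHom) l₀ < freeProlRank J l₀) →
      {l ∈ S | l.Prime} ⊆ thetaSet J 2)
    (H : Subgroup E.arith) (hH : IsOpen (H : Set E.arith)) (h2 : 2 ≤ (thetaSet H 1).encard) :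
    {l ∈ S | l.Prime} ⊆ thetaSet H 2 := by
  obtain ⟨J, hJ, hJH, l, hl, hlS, -, h2J, h1G⟩ :=
    MLFBase.exists_open_rankExcess_of_two_le_encard B hΔS H hH h2
  have hex : freeProlRank (J.map E.aug.toMonoidHom) l < freeProlRank J l := by
    rw [h1G]
    exact lt_of_lt_of_le (by norm_num) h2J
  exact (hook J hJ ⟨l, hl, hlS, hex⟩).trans (thetaSet_mono_of_isOpen hJ hJH 2)

/-- **[AbsTopI] Thm 2.6 (iii) (typed `E.Thm26iii S`), both clauses, from the hook** — clause one is
abc-iut-w6-d073's `thetaSet_two_subset_of_isProSet` (via `thm26iii_iff_of_isProSet`), clause two is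
`subset_thetaSet_two_of_hook` at `H = Π`.  Inputs: MLF base data, `Π` tfg (Thm 2.6 (ii) clause one),
`Δ` pro-`Σ`, and the Lemma 2.7 (iii) hook. [cite: MochizukiAbsTopI2012, Thm 2.6 (iii) p.22] -/
theorem MLFBase.thm26iii_of_hook (B : E.MLFBase) {S : Set ℕ}
    (htfg : IsTopologicallyFinitelyGenerated E.arith) (hΔS : IsProSet E.geom S)
    (hook : ∀ (J : Subgroup E.arith), IsOpen (J : Set E.arith) →
      (∃ (l₀ : ℕ) (_ : Fact l₀.Prime), l₀ ∈ S ∧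
        freeProlRank (J.map E.aug.toMonoidHom) l₀ < freeProlRank J l₀) →
      {l ∈ S | l.Prime} ⊆ thetaSet J 2) :
    E.Thm26iii S := by
  refine (E.thm26iii_iff_of_isProSet B htfg hΔS).2 fun h2 => ?_
  have htop : IsOpen ((⊤ : Subgroup E.arith) : Set E.arith) := by
    rw [Subgroup.coe_top]; exact isOpen_univ
  obtain ⟨e⟩ := nonempty_continuousMulEquiv_of_eq_top (⊤ : Subgroup E.arith) rfl
  rw [← thetaSet_eq_of_continuousMulEquiv e 1] at h2
  rw [← thetaSet_eq_of_continuousMulEquiv e 2]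
  exact MLFBase.subset_thetaSet_two_of_hook B hΔS hook ⊤ htop h2

/-- **[AbsTopI] Thm 2.6 (v), GENERAL form, for EVERY `Σ ⊆ Primes`, from the hook** (typed
`E.Thm26vFull B`): inputs `Δ` tfg (Prop 2.2), `Π` tfg (Thm 2.6 (ii) clause one), `Δ` pro-`Σ`, the
Lemma 2.7 (iii) hook, and — only when `Σ ⊇ Primes` — the rank identity of (ii) for every open `Π′`.
For `Σ` missing a prime the hook and the rank identity are idle (`thm26vFull_of_exists_prime_not_mem`).
[cite: MochizukiAbsTopI2012, Thm 2.6 (v) p.22] -/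
theorem MLFBase.thm26vFull_of_hook (B : E.MLFBase) (S : Set ℕ) (hS : S ⊆ {q | q.Prime})
    (hΔ : E.GeomTFG) (htfg : IsTopologicallyFinitelyGenerated E.arith) (hΔS : IsProSet E.geom S)
    (hQ : (∀ q : ℕ, q.Prime → q ∈ S) → ∀ (P : Subgroup E.arith), IsOpen (P : Set E.arith) →
      ∃ m : ℕ, ∀ (l : ℕ) [Fact l.Prime],
        freeProlRank P l = freeProlRank (P.map E.aug.toMonoidHom) l + m)
    (hook : ∀ (J : Subgroup E.arith), IsOpen (J : Set E.arith) →
      (∃ (l₀ : ℕ) (_ : Fact l₀.Prime), l₀ ∈ S ∧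
        freeProlRank (J.map E.aug.toMonoidHom) l₀ < freeProlRank J l₀) →
      {l ∈ S | l.Prime} ⊆ thetaSet J 2) :
    E.Thm26vFull B :=
  MLFBase.thm26vFull_of_isProSet_of_subset B S hS hΔ htfg hΔS hQ fun _ H hH h2 =>
    MLFBase.subset_thetaSet_two_of_hook B hΔS hook H hH h2

/-- **The `Σ = Primes` regime of [IUTchI–III] from the printed hypotheses and the hook**: splitting
over an open subgroup of `G`, `Δ` tfg and (∗) ([AbsAnab] Lemma 1.1.4 (ii) — they discharge the rank
identity), `Π` tfg, and the Lemma 2.7 (iii) hook give the typed `E.Thm26vFull B`.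
[cite: MochizukiAbsTopI2012, Thm 2.6 (v) p.22] -/
theorem MLFBase.thm26vFull_of_starCondition_of_hook (B : E.MLFBase) (hs : E.SplitsOverOpenSubgroup)
    (hΔ : E.GeomTFG) (hstar : E.StarCondition) (htfg : IsTopologicallyFinitelyGenerated E.arith)
    (hook : ∀ (J : Subgroup E.arith), IsOpen (J : Set E.arith) →
      (∃ (l₀ : ℕ) (_ : Fact l₀.Prime),
        freeProlRank (J.map E.aug.toMonoidHom) l₀ < freeProlRank J l₀) →
      {l | l.Prime} ⊆ thetaSet J 2) :
    E.Thm26vFull B := by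
  refine MLFBase.thm26vFull_of_starCondition_of_subset B hs hΔ hstar htfg fun H hH h2 => ?_
  have h := MLFBase.subset_thetaSet_two_of_hook B (S := {q | q.Prime}) ⟨fun U _ _ q hq _ => hq⟩
    (fun J hJ hex => ?_) H hH h2
  · intro l hl
    exact h ⟨hl, hl⟩
  · obtain ⟨l₀, hl₀, -, hlt⟩ := hex
    intro l hl
    exact hook J hJ ⟨l₀, hl₀, hlt⟩ hl.2

end FundamentalExtension

end Literature.AnabelianGeometry.AbsoluteAnabelian

end
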